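import Summits.CriticalPhenomena.PercolationContinuityZ3.Theorems.PercNearOneGluingNoHeavyPcintBFibProcess
import Summits.CriticalPhenomena.PercolationContinuityZ3.Theorems.PercNearOneGluingNoHeavyPcintVdBEFibreBasic
import Literature.Probability.LatticeModels.TriangularLatticeProofs
import HarnessLib

/-!
# PCINT lane, T-fibre route PHASE 3 (bond), step (3): the fibres of the bond fibre process factorise

Cell `prim-pcint`, seat `prim-pcint-1` (gen 13); memo `run/shared/lean/prim/pcint/T-FIBRE-ROUTE.md` (PHASE 3).

The structural ("Markov") half of the domination step for the bond oracle `BFib.outB` run with the edge exploration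
`EdgeExpl.rule` (the analogue of `…PcintUFibFactor.lean`).  Blocks are resampled with `AdaptDom.mixG` on the block index
`↥Λ ⊕ ↥EΛ`.

* `traj`, `FibB`, `run_eq_iff_fibB` — the replayed trajectory of a state and the fibre tests (`AdaptDom.run_eq_iff_replay`).
* `exists_entry` — a reached site other than the root was ENTERED (from the site selected at an earlier step);
  `usableAt_traj_sel` — the usable set the oracle reads for the selected site is its run value.
* `usableX_mixG_eq` — LOCALITY: resampling blocks that are neither the site block nor the entry-edge block of a site entered
  before step `N` (one exceptional site `c` allowed) does not change the usable sets of the sites `≠ c`.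
* `StepB` — the step context: state `σ = traj σ n`, selected site `c ≠ o` entered at step `k₀ < n` from `d` through `e₀`;
  `W₀ = {block of c, block of e₀} ∪ blocks of the children edges C`; the TYPE `H w` = usable set of `d` then;
  **`fibB_mixG_iff`**: `FibB (mixG W₀ u w) ↔ FibRest w ∧ meetsU (hOf u e₀) (H w)`; `outB_mixG_children`: the children report
  `meetsU (hOf u e) (υ grow (hOf u e₀) (H w) (yOf u c))`; `card_C_succ_le : #C + 1 ≤ 6`.
* The origin step (`c = o`) is in `…PcintBFibFactorOrigin.lean`.
-/

noncomputable section

namespace Summit.CriticalPhenomena.PercolationContinuityZ3.Theorems.Pcint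

namespace BFib

open Finset AdaptDom EdgeExpl UFib Literature.Probability.Percolation Literature.Probability.LatticeModels

variable {Φ : Type*} [Fintype Φ] {Λ : Finset (Site 2)} (o : ↥Λ) (enc : ↥Λ → ℕ)
  (grow : (Φ × Φ → Bool) → Φ → Finset Φ)

/-! ### The replayed trajectory and the fibre tests -/

/-- The `k`-th state of the replay of `σ`. -/
def traj (σ : ↥(EΛ triGraph Λ) → Option Bool) (k : ℕ) : ↥(EΛ triGraph Λ) → Option Bool :=
  run (rule o enc) (readOut σ) k

/-- **The fibre tests** (a predicate of this file, not a cited fact): `w` passes iff at every replayed state before step `n`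
the bond oracle reports, on every examined edge, the value recorded in `σ`. -/
def FibB (n : ℕ) (σ : ↥(EΛ triGraph Λ) → Option Bool) (w : (↥Λ ⊕ ↥(EΛ triGraph Λ)) → Blk Φ) : Prop :=
  ∀ k < n, ∀ e ∈ rule o enc (traj o enc σ k), outB o enc grow w (traj o enc σ k) e = (σ e).getD false

/-- **Fibres of the run**: `run_n(w) = σ` iff `σ` is its own replay and `w` passes the fibre tests. -/
theorem run_eq_iff_fibB (n : ℕ) (σ : ↥(EΛ triGraph Λ) → Option Bool) (w : (↥Λ ⊕ ↥(EΛ triGraph Λ)) → Blk Φ) :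
    run (rule o enc) (outB o enc grow w) n = σ ↔ traj o enc σ n = σ ∧ FibB o enc grow n σ w :=
  run_eq_iff_replay (rule_unrevealed (o := o) (enc := enc)) _ n σ

variable {o enc grow}

/-! ### Entry of reached sites; the usable set read for the selected site -/

/-- **A reached site other than the root was entered**: from the site selected at some earlier step. -/
theorem exists_entry (x : (↥(EΛ triGraph Λ) → Option Bool) → ↥(EΛ triGraph Λ) → Bool) {k : ℕ} {b : ↥Λ}
    (hb : b ∈ reached o (run (rule o enc) x k)) (hbo : b ≠ o) :
    ∃ j < k, ∃ d : ↥Λ, sel o enc (run (rule o enc) x j) = some d ∧ Entered o enc x (run (rule o enc) x j) d b := by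
  classical
  have hex : ∃ j, b ∈ reached o (run (rule o enc) x j) := ⟨k, hb⟩
  have hj₀b : b ∈ reached o (run (rule o enc) x (Nat.find hex)) := Nat.find_spec hex
  have hj₀k : Nat.find hex ≤ k := Nat.find_min' hex hb
  -- `Nat.find hex ≥ 1`: at step `0` only the root is reached
  obtain ⟨j, hj⟩ : ∃ j, Nat.find hex = j + 1 := by
    rcases Nat.eq_zero_or_pos (Nat.find hex) with h0 | hpos
    · exfalso
      rw [h0] at hj₀b
      rcases mem_reached_iff.1 hj₀b with h | ⟨e, he, -⟩
      · exact hbo h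
      · simp [run] at he
    · exact ⟨Nat.find hex - 1, by omega⟩
  have hnot : b ∉ reached o (run (rule o enc) x j) := Nat.find_min hex (by omega)
  rw [hj] at hj₀b hj₀k
  rcases mem_reached_iff.1 hj₀b with h | ⟨e, he, hbe⟩
  · exact absurd h hbo
  · -- the open edge `e ∋ b` was revealed at this very step
    set τ := run (rule o enc) x j with hτ
    have heR : e ∈ rule o enc τ := by
      by_contra heR
      have : run (rule o enc) x (j + 1) e = τ e := by
        change stepPA (rule o enc τ) τ (x τ) e = τ e; simp [stepPA, heR]
      rw [this] at he
      exact hnot (mem_reached_iff.2 (Or.inr ⟨e, he, hbe⟩))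
    obtain ⟨d, hsel, -, a, ha, hea⟩ := exists_of_mem_rule heR
    have hx : x τ e = true := by
      have := run_succ_apply_of_mem x j heR; rw [he] at this; exact (Option.some.inj this).symm
    refine ⟨j, by omega, d, hsel, e, heR, ?_, hx⟩
    rw [hea] at hbe ⊢
    rcases Sym2.mem_iff.1 hbe with hbd | hba
    · exfalso
      have hbd' : b = d := Subtype.ext hbd
      rw [hbd'] at hnot
      exact hnot (sel_reached hsel).1
    · rw [show b = a from Subtype.ext hba]

/-- **The usable set read for the selected site is its run value**: at `τ = run x k` with selected site `b`,
`usableAt w τ b = usableX w x k b` (for the replay oracle `x = readOut σ`, `τ = traj σ k`). -/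
theorem usableAt_sel (w : (↥Λ ⊕ ↥(EΛ triGraph Λ)) → Blk Φ) (σ : ↥(EΛ triGraph Λ) → Option Bool) {k : ℕ} {b : ↥Λ}
    (hsel : sel o enc (traj o enc σ k) = some b) :
    usableAt o enc grow w (traj o enc σ k) b = usableX o enc grow w (readOut σ) k b := by
  by_cases hbo : b = o
  · subst hbo; rw [usableAt_root, usableX_root]
  · obtain ⟨j, hj, d, hseld, hent⟩ := exists_entry (readOut σ) (sel_reached hsel).1 hbo
    unfold traj
    rw [usableAt_run w (readOut σ) hj hseld hent, usableX_stable w (readOut σ) hseld hent k (by omega)]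

/-! ### Locality of usable sets under resampling -/

/-- **Locality**: let `W` be a set of blocks containing no site block other than possibly that of `c`, and no block of the
entry edge of a site `≠ c` entered before step `N` of the replay of `σ`; assume no site selected before `N` is `c`.  Then
resampling `W` does not change the usable sets of the sites other than `c` up to step `N`. -/
theorem usableX_mixG_eq (σ : ↥(EΛ triGraph Λ) → Option Bool) (W : Finset (↥Λ ⊕ ↥(EΛ triGraph Λ))) (c : ↥Λ) (N : ℕ)
    (hW1 : ∀ v, v ≠ c → Sum.inl v ∉ W)
    (hW2 : ∀ j < N, ∀ b v : ↥Λ, sel o enc (traj o enc σ j) = some b → Entered o enc (readOut σ) (traj o enc σ j) b v →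
      v ≠ c → ∀ e : ↥(EΛ triGraph Λ), (e : Sym2 (Site 2)) = s(b.1, v.1) → Sum.inr e ∉ W)
    (hW3 : ∀ j < N, ∀ b : ↥Λ, sel o enc (traj o enc σ j) = some b → b ≠ c)
    (hW4 : c ≠ o → Sum.inl o ∉ W)
    (u w : (↥Λ ⊕ ↥(EΛ triGraph Λ)) → Blk Φ) :
    ∀ k ≤ N, ∀ v, v ≠ c → usableX o enc grow (mixG W u w) (readOut σ) k v = usableX o enc grow w (readOut σ) k v := by
  intro k hk
  induction k with
  | zero =>
    intro v hvc
    simp only [usableX]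
    by_cases hvo : v = o
    · have ho : Sum.inl o ∉ W := hW4 (fun h => hvc (hvo.trans h.symm))
      rw [if_pos hvo, if_pos hvo]
      unfold rootU; simp only [mixG_of_not_mem ho]
    · rw [if_neg hvo, if_neg hvo]
  | succ k ih =>
    intro v hvc
    have ih' := ih (Nat.le_of_succ_le hk)
    have hkN : k < N := Nat.lt_of_succ_le hk
    cases hs : sel o enc (traj o enc σ k) with
    | none =>
      unfold traj at hs
      rw [usableX_succ_of_none _ _ hs, usableX_succ_of_none _ _ hs]; exact ih' v hvc
    | some b =>
      have hbc : b ≠ c := hW3 k hkN b hs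
      have hs' := hs
      unfold traj at hs'
      by_cases hent : Entered o enc (readOut σ) (run (rule o enc) (readOut σ) k) b v
      · rw [usableX_succ_of_entered _ _ hs' hent, usableX_succ_of_entered _ _ hs' hent, ih' b hbc]
        have hy : yOf (mixG W u w) v = yOf w v := by
          funext q; simp only [yOf, mixG_of_not_mem (hW1 v hvc)]
        have hh : hE (mixG W u w) b v = hE w b v := by
          funext i
          unfold hE
          split_ifs with hmem
          · rw [mixG_of_not_mem (hW2 k hkN b v hs hent hvc ⟨_, hmem⟩ rfl)]
          · rfl
        rw [hy, hh]
      · rw [usableX_succ_of_not_entered _ _ hs' hent, usableX_succ_of_not_entered _ _ hs' hent]; exact ih' v hvc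

/-! ### The general step: selected site `c ≠ o` entered at `k₀` from `d` through `e₀` -/

variable (o enc) in
/-- **Step context** (hypothesis structure of this file): a state `σ` equal to its own `n`-step replay, with selected site
`c ≠ o`, which was entered at the earlier step `k₀` from the site `d` selected then, through the edge `e₀ = {d, c}`. -/
structure StepB where
  /-- number of steps -/
  n : ℕ
  /-- the state -/
  σ : ↥(EΛ triGraph Λ) → Option Bool
  /-- the selected site of `σ` (parent of the children examined next) -/
  c : ↥Λ
  /-- the step at which `c` was entered -/
  k₀ : ℕ
  /-- the site selected at step `k₀` -/
  d : ↥Λ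
  /-- the entry edge of `c` -/
  e₀ : ↥(EΛ triGraph Λ)
  /-- `σ` is its own replay -/
  hcons : traj o enc σ n = σ
  /-- `c` is selected at `σ` -/
  hsel : sel o enc σ = some c
  /-- `c` is not the root -/
  hco : c ≠ o
  /-- `k₀` is before `n` -/
  hk₀ : k₀ < n
  /-- `d` is selected at step `k₀` -/
  hseld : sel o enc (traj o enc σ k₀) = some d
  /-- `e₀` is examined at step `k₀` -/
  he₀R : e₀ ∈ rule o enc (traj o enc σ k₀)
  /-- `e₀ = {d, c}` -/
  he₀ : (e₀ : Sym2 (Site 2)) = s(d.1, c.1)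
  /-- `e₀` is revealed open -/
  hσe₀ : σ e₀ = some true

variable (X : StepB (Λ := Λ) o enc)

namespace StepB

/-- The children edges of `c` (examined next). -/
def C : Finset ↥(EΛ triGraph Λ) := rule o enc X.σ

/-- The resampled blocks: the site block of `c`, the block of its entry edge, the blocks of the children edges. -/
def W₀ : Finset (↥Λ ⊕ ↥(EΛ triGraph Λ)) := insert (Sum.inl X.c) (insert (Sum.inr X.e₀) (X.C.image Sum.inr))

/-- `c` is entered at step `k₀` from `d` (under the replay oracle). -/
theorem entered : Entered o enc (readOut X.σ) (traj o enc X.σ X.k₀) X.d X.c :=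
  ⟨X.e₀, X.he₀R, X.he₀, by simp [readOut, X.hσe₀]⟩

/-- The selected site at `σ` in replay form. -/
theorem hsel' : sel o enc (traj o enc X.σ X.n) = some X.c := by rw [X.hcons]; exact X.hsel

/-- **A site selected before step `n` is not `c`.** -/
theorem sel_ne_c {k : ℕ} (hk : k < X.n) {b : ↥Λ} (hb : sel o enc (traj o enc X.σ k) = some b) : b ≠ X.c := by
  intro hbc; subst hbc
  exact sel_unique (readOut X.σ) hk hb X.hsel'

/-- An edge examined before step `n` is revealed at `σ`, hence is not a child. -/
theorem not_mem_C_of_examined {k : ℕ} (hk : k < X.n) {e : ↥(EΛ triGraph Λ)} (he : e ∈ rule o enc (traj o enc X.σ k)) :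
    e ∉ X.C := by
  intro heC
  have h1 := run_apply_of_mem (rule_unrevealed (o := o) (enc := enc)) (readOut X.σ) hk he
  have hc := X.hcons
  unfold traj at hc
  rw [hc] at h1
  exact absurd (rule_unrevealed X.σ e heC) (by rw [h1]; simp)

/-- Membership of a site block in `W₀`. -/
theorem inl_mem_W₀_iff {v : ↥Λ} : Sum.inl v ∈ X.W₀ ↔ v = X.c := by
  unfold W₀
  simp only [mem_insert, Sum.inl.injEq, reduceCtorEq, mem_image, and_false, exists_false, or_false]

/-- Membership of an edge block in `W₀`. -/
theorem inr_mem_W₀_iff {e : ↥(EΛ triGraph Λ)} : Sum.inr e ∈ X.W₀ ↔ e = X.e₀ ∨ e ∈ X.C := by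
  unfold W₀
  simp only [mem_insert, reduceCtorEq, Sum.inr.injEq, mem_image, false_or]
  constructor
  · rintro (h | ⟨e', he', h⟩)
    · exact Or.inl h
    · exact Or.inr (h ▸ he')
  · rintro (h | h)
    · exact Or.inl h
    · exact Or.inr ⟨e, h, rfl⟩

/-- The block of `c` is resampled. -/
theorem inl_c_mem : Sum.inl X.c ∈ X.W₀ := X.inl_mem_W₀_iff.2 rfl

/-- The block of `e₀` is resampled. -/
theorem inr_e₀_mem : Sum.inr X.e₀ ∈ X.W₀ := X.inr_mem_W₀_iff.2 (Or.inl rfl)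

/-- The blocks of the children are resampled. -/
theorem inr_mem_of_mem_C {e : ↥(EΛ triGraph Λ)} (he : e ∈ X.C) : Sum.inr e ∈ X.W₀ := X.inr_mem_W₀_iff.2 (Or.inr he)
/-- **The entry edge of a site `v ≠ c` entered before step `n` is not resampled.** -/
theorem inr_not_mem_of_entered {j : ℕ} (hj : j < X.n) {b v : ↥Λ} (hb : sel o enc (traj o enc X.σ j) = some b)
    (hent : Entered o enc (readOut X.σ) (traj o enc X.σ j) b v) (hvc : v ≠ X.c) (e : ↥(EΛ triGraph Λ))
    (he : (e : Sym2 (Site 2)) = s(b.1, v.1)) : Sum.inr e ∉ X.W₀ := by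
  rw [X.inr_mem_W₀_iff]
  rintro (h | h)
  · -- `e = e₀ = {d, c}` while `e = {b, v}` with `v ≠ c` and `b ≠ c`
    subst h
    have := X.he₀; rw [he] at this
    rcases Sym2.eq_iff.1 this with ⟨_, h2⟩ | ⟨h1, _⟩
    · exact hvc (Subtype.ext h2)
    · exact X.sel_ne_c hj hb (Subtype.ext h1)
  · -- the entry edge was examined at step `j < n`
    obtain ⟨e', he'R, he'v, -, -, -⟩ := entered_spec (readOut X.σ) hb hent
    have : e' = e := Subtype.ext (he'v.trans he.symm)
    exact X.not_mem_C_of_examined hj (this ▸ he'R) h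

/-- Locality for `W₀` with exceptional site `c`, up to step `n`. -/
theorem usableX_mixG_W₀ (u w : (↥Λ ⊕ ↥(EΛ triGraph Λ)) → Blk Φ) :
    ∀ k ≤ X.n, ∀ v, v ≠ X.c → usableX o enc grow (mixG X.W₀ u w) (readOut X.σ) k v = usableX o enc grow w (readOut X.σ) k v :=
  usableX_mixG_eq X.σ X.W₀ X.c X.n (fun _ hv h => hv (X.inl_mem_W₀_iff.1 h))
    (fun _ hj _ _ hb hent hvc e he => X.inr_not_mem_of_entered hj hb hent hvc e he)
    (fun _ hj _ hb => X.sel_ne_c hj hb) (fun _ h => X.hco.symm (X.inl_mem_W₀_iff.1 h)) u w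

/-- **The type of the step**: the usable set of `d` at the entry of `c`. -/
def H (w : (↥Λ ⊕ ↥(EΛ triGraph Λ)) → Blk Φ) : Finset Φ := usableX o enc grow w (readOut X.σ) X.k₀ X.d

/-- The type does not read `W₀`. -/
theorem H_mixG (u w : (↥Λ ⊕ ↥(EΛ triGraph Λ)) → Blk Φ) : X.H (grow := grow) (mixG X.W₀ u w) = X.H (grow := grow) w :=
  X.usableX_mixG_W₀ u w X.k₀ X.hk₀.le X.d (X.sel_ne_c X.hk₀ X.hseld)

/-- The fibre tests other than the test of `e₀` (at step `k₀`) (a predicate of this file, not a cited fact). -/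
def FibRest (w : (↥Λ ⊕ ↥(EΛ triGraph Λ)) → Blk Φ) : Prop :=
  ∀ k < X.n, ∀ e ∈ rule o enc (traj o enc X.σ k), ¬ (k = X.k₀ ∧ e = X.e₀) →
    outB o enc grow w (traj o enc X.σ k) e = (X.σ e).getD false

/-- **The tests of `FibRest` do not read `W₀`.** -/
theorem fibRest_mixG_iff (u w : (↥Λ ⊕ ↥(EΛ triGraph Λ)) → Blk Φ) :
    X.FibRest (grow := grow) (mixG X.W₀ u w) ↔ X.FibRest (grow := grow) w := by
  have key : ∀ k < X.n, ∀ e ∈ rule o enc (traj o enc X.σ k), ¬ (k = X.k₀ ∧ e = X.e₀) →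
      outB o enc grow (mixG X.W₀ u w) (traj o enc X.σ k) e = outB o enc grow w (traj o enc X.σ k) e := by
    intro k hk e he hne
    cases hs : sel o enc (traj o enc X.σ k) with
    | none => rw [outB_none _ hs, outB_none _ hs]
    | some b =>
      have heW : Sum.inr e ∉ X.W₀ := by
        rw [X.inr_mem_W₀_iff]
        rintro (h | h)
        · subst h
          exact hne ⟨step_unique (rule_unrevealed (o := o) (enc := enc)) (readOut X.σ) he X.he₀R, rfl⟩
        · exact X.not_mem_C_of_examined hk he h
      have hh : hOf (mixG X.W₀ u w) e = hOf w e := by funext i; simp only [hOf, mixG_of_not_mem heW]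
      rw [outB_sel _ hs, outB_sel _ hs, hh, usableAt_sel _ _ hs, usableAt_sel _ _ hs,
        X.usableX_mixG_W₀ u w k hk.le b (X.sel_ne_c hk hs)]
  constructor
  · intro h k hk e he hne; rw [← key k hk e he hne]; exact h k hk e he hne
  · intro h k hk e he hne; rw [key k hk e he hne]; exact h k hk e he hne

/-- The test of `e₀` at step `k₀` reads `meetsU (hOf u e₀) (H w)`. -/
theorem outB_test_e₀ (u w : (↥Λ ⊕ ↥(EΛ triGraph Λ)) → Blk Φ) :
    outB o enc grow (mixG X.W₀ u w) (traj o enc X.σ X.k₀) X.e₀ = meetsU (hOf u X.e₀) (X.H (grow := grow) w) := by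
  have hh : hOf (mixG X.W₀ u w) X.e₀ = hOf u X.e₀ := by funext i; simp only [hOf, mixG_of_mem X.inr_e₀_mem]
  rw [outB_sel _ X.hseld, hh, usableAt_sel _ _ X.hseld]
  exact congrArg _ (X.H_mixG u w)

/-- **The fibre factorisation**: `FibB (mixG W₀ u w) ↔ FibRest w ∧ meetsU (hOf u e₀) (H w)`. -/
theorem fibB_mixG_iff (u w : (↥Λ ⊕ ↥(EΛ triGraph Λ)) → Blk Φ) :
    FibB o enc grow X.n X.σ (mixG X.W₀ u w) ↔ X.FibRest (grow := grow) w ∧ meetsU (hOf u X.e₀) (X.H (grow := grow) w) = true := by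
  constructor
  · intro h
    refine ⟨(X.fibRest_mixG_iff u w).1 fun k hk e he _ => h k hk e he, ?_⟩
    have := h X.k₀ X.hk₀ X.e₀ X.he₀R
    rw [outB_test_e₀, X.hσe₀] at this
    exact this
  · rintro ⟨hrest, hmeet⟩ k hk e he
    by_cases hke : k = X.k₀ ∧ e = X.e₀
    · obtain ⟨rfl, rfl⟩ := hke
      rw [outB_test_e₀, X.hσe₀]; exact hmeet
    · exact ((X.fibRest_mixG_iff u w).2 hrest) k hk e he hke

/-- **The usable set of `c` at `σ`** (resampled): `υ grow (hOf u e₀) (H w) (yOf u c)`. -/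
theorem usableAt_σ_c (u w : (↥Λ ⊕ ↥(EΛ triGraph Λ)) → Blk Φ) :
    usableAt o enc grow (mixG X.W₀ u w) X.σ X.c = υ grow (hOf u X.e₀) (X.H (grow := grow) w) (yOf u X.c) := by
  have h1 : usableAt o enc grow (mixG X.W₀ u w) X.σ X.c = usableAt o enc grow (mixG X.W₀ u w) (traj o enc X.σ X.n) X.c := by
    rw [X.hcons]
  rw [h1, usableAt_sel _ _ X.hsel']
  have hseld := X.hseld
  unfold traj at hseld
  rw [usableX_stable _ _ hseld X.entered X.n (Nat.succ_le_of_lt X.hk₀), usableX_succ_of_entered _ _ hseld X.entered,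
    hE_eq_hOf _ X.he₀]
  have hh : hOf (mixG X.W₀ u w) X.e₀ = hOf u X.e₀ := by funext i; simp only [hOf, mixG_of_mem X.inr_e₀_mem]
  have hy : yOf (mixG X.W₀ u w) X.c = yOf u X.c := by funext q; simp only [yOf, mixG_of_mem X.inl_c_mem]
  rw [hh, hy]
  exact congrArg (fun T => υ grow (hOf u X.e₀) T (yOf u X.c)) (X.H_mixG u w)

/-- **At `σ` the children report `meetsU (hOf u e) (υ grow (hOf u e₀) (H w) (yOf u c))`** (for a step test function of `C`). -/
theorem outB_mixG_children (u w : (↥Λ ⊕ ↥(EΛ triGraph Λ)) → Blk Φ) {g : (↥(EΛ triGraph Λ) → Bool) → ℝ}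
    (hg : StepTest X.C g) :
    g (outB o enc grow (mixG X.W₀ u w) X.σ) =
      g (fun e => if e ∈ X.C then meetsU (hOf u e) (υ grow (hOf u X.e₀) (X.H (grow := grow) w) (yOf u X.c)) else false) := by
  refine hg.2 _ _ fun e he => ?_
  have hh : hOf (mixG X.W₀ u w) e = hOf u e := by funext i; simp only [hOf, mixG_of_mem (X.inr_mem_of_mem_C he)]
  rw [if_pos he, outB_sel _ X.hsel, hh, usableAt_σ_c]

/-- `d` is reached at `σ`. -/
theorem d_mem_reached : X.d ∈ reached o X.σ := by
  have h := reached_mono (readOut X.σ) X.hk₀.le (sel_reached X.hseld).1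
  have hc := X.hcons
  unfold traj at h hc
  rw [hc] at h
  exact h

/-- **A non-root parent has at most `5` children** (stated as `#C + 1 ≤ 6`): the children edges lead from `c` to distinct
unreached neighbours of `c` in `𝕋` (degree `6`), none of which is the reached site `d`. -/
theorem card_C_succ_le : X.C.card + 1 ≤ 6 := by
  suffices h : X.C.card ≤ 5 by omega
  classical
  have hadj_dc : triGraph.Adj X.d.1 X.c.1 := (SimpleGraph.mem_edgeSet triGraph).1 (X.he₀ ▸ (mem_EΛ_iff.1 X.e₀.2).2)
  -- the pairs of the children are `s(c, a)` for `a` in the neighbours of `c` other than `d`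
  have hsub : X.C.image (fun e : ↥(EΛ triGraph Λ) => (e : Sym2 (Site 2))) ⊆
      ((triGraph.neighborFinset X.c.1).erase X.d.1).image fun a => s(X.c.1, a) := by
    intro p hp
    obtain ⟨e, he, rfl⟩ := mem_image.1 hp
    have he' := he
    unfold C at he'
    rw [rule_of_sel X.hsel, mem_linkable_iff] at he'
    obtain ⟨-, a, ha, hea⟩ := he'
    have hadj : triGraph.Adj X.c.1 a.1 := (SimpleGraph.mem_edgeSet triGraph).1 (hea ▸ (mem_EΛ_iff.1 e.2).2)
    refine mem_image.2 ⟨a.1, mem_erase.2 ⟨fun had => ha ?_, (SimpleGraph.mem_neighborFinset _ _ _).2 hadj⟩, hea.symm⟩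
    rw [show a = X.d from Subtype.ext had]; exact X.d_mem_reached
  have hinj : Set.InjOn (fun e : ↥(EΛ triGraph Λ) => (e : Sym2 (Site 2))) ↑X.C := fun a _ b _ h => Subtype.ext h
  calc X.C.card = (X.C.image fun e : ↥(EΛ triGraph Λ) => (e : Sym2 (Site 2))).card := (card_image_of_injOn hinj).symm
    _ ≤ (((triGraph.neighborFinset X.c.1).erase X.d.1).image fun a => s(X.c.1, a)).card := card_le_card hsub
    _ ≤ ((triGraph.neighborFinset X.c.1).erase X.d.1).card := card_image_le
    _ = 6 - 1 := by
        rw [card_erase_of_mem ((SimpleGraph.mem_neighborFinset _ _ _).2 hadj_dc.symm), card_neighborFinset_triGraph_holds]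
    _ = 5 := rfl

/-- The entry edge `e₀` is revealed, the children are not: `e₀ ∉ C`. -/
theorem e₀_not_mem_C : X.e₀ ∉ X.C := fun h => absurd (rule_unrevealed X.σ X.e₀ h) (by rw [X.hσe₀]; simp)

end StepB

end BFib

end Summit.CriticalPhenomena.PercolationContinuityZ3.Theorems.Pcint

end
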